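import Literature.NumberTheory.EllipticCurves.HaberlandRationalityProofs
import HarnessLib

/-!
# Paşol–Popa, *Modular forms and period polynomials*, Prop. 5.11 / Cor. 5.12 — the corrected
# statement of `PasolPopa2013_criticalValuesRationality` and its proof

The named fact `PasolPopa2013_criticalValuesRationality` (file `PeriodRationality.lean`) transcribes
Prop. 5.11(b) of [PP] with the normalisation `ω⁺ \overline{ω⁻}/(i (2π)^{k-1} (f,f)) ∈ K_f`.  This is a
misprint in the published statement (the proof in [PP, §5] and Thm. 3.3 give `2^{k-1}`, the factor
`(2π)^{k-1}` having already been absorbed into the completed values `Λ(s,f) = (2π)^{-s}Γ(s)L(s,f)`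
which define `ω^±`); as transcribed the statement is false — for `f = Δ` one has
`Λ(1,Δ)Λ(2,Δ)/(Δ,Δ) = 2¹³·3²/(5·691) ∈ ℚ` (Zagier), so the `(2π)^{11}` version would put `π¹¹` in `ℚ`.

This file vendors the corrected statement `PasolPopa2013_criticalValuesRationalityCorrected`
(identical to the original except for `(2 : ℂ) ^ (k - 1)` in place of `(2 * Real.pi : ℂ) ^ (k - 1)` in
clause (b), for even and for odd `k`) and PROVES it:

* all clauses except (b) in even weight `k ≥ 4`, and the whole statement in weight `2` and in the
  vacuous odd / small weights, are `PasolPopa2013_criticalValuesRationality_corrected_of_partB`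
  (`PeriodRationalityProofs.lean`: Eichler–Shimura–Manin rationality of the critical values through the
  cuspidal lattice of M-symbol functionals, [PP] Cor. 5.12, Prop. 5.11(c));
* clause (b) in even weight `k = n + 2 ≥ 4` is Haberland's formula for `Γ₀(N)` ([PP] Thm. 3.2(a),
  `HaberlandAlgebra.six_mul_petersson_eq_sum_coset`, proved in `HaberlandFormulaProofs.lean` by Stokes on the
  standard fundamental domain) combined with [PP] Lemma 4.1 (the coboundary classes are in the radical of
  the Haberland pairing, `HaberlandRationality.haberlandForm_self_inQuad`): it gives
  `6 (2i)ⁿ⁺¹ (f,f) = aΩ⁺² + bΩ⁻² + cΩ⁺Ω⁻ i` with `a, b, c ∈ K_f` (a real field), whence, comparing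
  imaginary parts, `Ω⁺Ω⁻/(f,f) ∈ K_f`, which is (b) for `ω⁺ = Ω⁻ i`, `ω⁻ = Ω⁺`.

## References
* [PP] V. Paşol, A. A. Popa, *Modular forms and period polynomials*, Proc. LMS 107 (2013), Prop. 5.11,
  Cor. 5.12, Thm. 3.2, Thm. 3.3, Lemma 4.1. [cite: PasolPopa2013]
-/

open MeasureTheory Set Filter Topology Complex
open scoped ComplexConjugate UpperHalfPlane MatrixGroups ModularForm

namespace Literature.NumberTheory.EllipticCurves.ModularForms

open ModularGroup CongruenceSubgroup

variable {N : ℕ} [NeZero N] {n : ℕ}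

/-- **Haberland's formula ⇒ [PP] Prop. 5.11(b) (corrected normalisation), moment form.** For a newform
`f ∈ S_{n+2}(Γ₀(N))`, `n ≥ 2` even, and real periods `Ω⁺, Ω⁻` such that every rational cuspidal M-symbol
functional takes `f` into `K_fΩ⁺ + K_fΩ⁻ i`, one has `Ω⁺Ω⁻/(f,f) ∈ K_f`. [cite: PasolPopa2013, Prop. 5.11(b) and Thm. 3.3] -/
theorem IsNewform0.periods_div_petersson_mem_coeffField (hn : Even n) (hn0 : n ≠ 0)
    {f : CuspForm (Gamma0 N) (n + 2)} (hf : IsNewform0 f) {Ωp Ωm : ℝ}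
    (hΩ : ∀ φ ∈ cuspidalLatticeK (N := N) n, ∃ a b : ℂ, a ∈ coeffField f ∧ b ∈ coeffField f ∧
      φ f = a * Ωp + b * Ωm * I) :
    (Ωp : ℂ) * Ωm / peterssonProduct (Gamma0 N) (n + 2) f f ∈ coeffField f := by
  obtain ⟨g, hg⟩ := exists_mapGL_eq_out (N := N)
  obtain ⟨a, b, c, ha, hb, hc, habc⟩ := HaberlandRationality.haberlandForm_self_inQuad hn hn0 hf hΩ
  rw [← HaberlandAlgebra.six_mul_petersson_eq_sum_coset g hg hn f f] at habc
  have hPreal := peterssonProduct_self_eq_ofReal (Gamma0 N) ((n : ℤ) + 2) f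
  set P := peterssonProduct (Gamma0 N) (n + 2) f f with hPdef
  have hPpos : 0 < P.re := peterssonProduct_self_pos_holds (Gamma0 N) ((n : ℤ) + 2) (IsNormalized.ne_zero_gamma0 hf.2.2)
  have hP0 : (P.re : ℂ) ≠ 0 := by exact_mod_cast hPpos.ne'
  have hK : ∀ z ∈ coeffField f, conj z = z := fun z hz ↦
    Complex.conj_eq_iff_im.mpr (hf.im_eq_zero_of_mem_coeffField hz)
  obtain ⟨t, rfl⟩ : ∃ t, n = 2 * t := ⟨n / 2, by obtain ⟨r, hr⟩ := hn; omega⟩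
  rw [hPreal] at habc ⊢
  have hconj := congrArg conj habc
  simp only [map_mul, map_add, map_pow, map_ofNat, Complex.conj_I, Complex.conj_ofReal, hK a ha,
    hK b hb, hK c hc] at hconj
  have hI : I ^ (2 * t + 1) = (-1) ^ t * I := by rw [pow_succ, pow_mul, I_sq]
  have e1 : (2 * I : ℂ) ^ (2 * t + 1) = 2 ^ (2 * t + 1) * ((-1) ^ t * I) := by rw [mul_pow, hI]
  have e2 : (2 * -I : ℂ) ^ (2 * t + 1) = -(2 ^ (2 * t + 1) * ((-1) ^ t * I)) := by
    rw [mul_neg, neg_pow, mul_pow, hI, Odd.neg_one_pow ⟨t, rfl⟩]; ring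
  rw [e1] at habc
  rw [e2] at hconj
  -- imaginary parts: `6·2ⁿ⁺¹(-1)ᵗ (f,f) = c Ω⁺Ω⁻`
  have key : (6 * 2 ^ (2 * t + 1) * (-1) ^ t * (P.re : ℂ)) = c * Ωp * Ωm := by
    apply mul_left_cancel₀ (two_ne_zero (α := ℂ))
    apply mul_right_cancel₀ I_ne_zero
    linear_combination habc - hconj
  have hc0 : c ≠ 0 := by
    rintro rfl
    have h60 : (6 * 2 ^ (2 * t + 1) * (-1) ^ t * (P.re : ℂ)) ≠ 0 :=
      mul_ne_zero (mul_ne_zero (mul_ne_zero (by norm_num) (pow_ne_zero _ two_ne_zero))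
        (pow_ne_zero _ (neg_ne_zero.mpr one_ne_zero))) hP0
    exact h60 (by rw [key]; ring)
  have hval : (Ωp : ℂ) * Ωm / (P.re : ℂ) = 6 * 2 ^ (2 * t + 1) * (-1) ^ t / c := by
    rw [div_eq_div_iff hP0 hc0]
    linear_combination -key
  rw [hval]
  refine div_mem (mul_mem (mul_mem ?_ (pow_mem ?_ _)) (pow_mem (neg_mem (one_mem _)) _)) hc
  · exact_mod_cast natCast_mem (coeffField f) 6
  · exact_mod_cast natCast_mem (coeffField f) 2

/-- **[PP] Prop. 5.11 (b),(c) and Cor. 5.12 for newforms of even weight `k ≥ 4` on `Γ₀(N)`, with the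
corrected normalisation `2^{k-1}` in (b).** With `ω⁺ = Ω⁻ i ∈ i^{k+1}ℝ`, `ω⁻ = Ω⁺ ∈ i^kℝ`
(`Ω^±` the real periods of `IsNewform0.exists_periods_criticalValues'`): the critical values
`iⁿ'Λ(n',f)/ω^±` lie in `K_f` (Cor. 5.12) and `ω⁺\overline{ω⁻}/(i 2^{k-1}(f,f)) = Ω⁺Ω⁻/(2^{k-1}(f,f)) ∈ K_f`
(Prop. 5.11(b), by Haberland's formula). [cite: PasolPopa2013, Prop. 5.11(b),(c), Cor. 5.12, Thm. 3.3] -/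
theorem IsNewform0.criticalValues_petersson_mem_coeffField {k : ℤ} {f : CuspForm (Gamma0 N) k}
    (hf : IsNewform0 f) (hk : Even k) (hk4 : 4 ≤ k) :
    ∃ ωp ωm : ℂ, ωp ≠ 0 ∧ ωm ≠ 0 ∧
      (∀ n' : ℕ, 0 < n' → (n' : ℤ) < k →
        ((n' : ℤ).negOnePow = (k - 1).negOnePow →
          I ^ n' * completedLValue f n' / ωp ∈ coeffField f) ∧
        ((n' : ℤ).negOnePow = -(k - 1).negOnePow →
          I ^ n' * completedLValue f n' / ωm ∈ coeffField f)) ∧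
      (ωp * (starRingEnd ℂ) ωm /
          (I * (2 : ℂ) ^ (k - 1) * peterssonProduct (Gamma0 N) k f f) ∈ coeffField f) ∧
      (∃ r : ℝ, ωp = I ^ (k + 1) * r) ∧ (∃ r : ℝ, ωm = I ^ k * r) := by
  obtain ⟨t, ht⟩ : ∃ t : ℕ, k = 2 * (t : ℤ) + 2 := by
    obtain ⟨r, hr⟩ := hk
    refine ⟨(r - 1).toNat, ?_⟩
    rw [Int.toNat_of_nonneg (by omega)]
    omega
  subst ht
  have ht0 : t ≠ 0 := by rintro rfl; simp at hk4
  set n : ℕ := 2 * t with hn_def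
  have hn : Even n := ⟨t, by omega⟩
  have hn0 : n ≠ 0 := by omega
  have hcast : (2 * (t : ℤ) + 2 : ℤ) = (n : ℤ) + 2 := by rw [hn_def]; push_cast; ring
  revert f
  rw [hcast]
  intro f hf
  obtain ⟨Ωp, Ωm, hp, hm, hΩ, hodd, heven⟩ := hf.exists_periods_criticalValues' hn hn0
  have hb := hf.periods_div_petersson_mem_coeffField hn hn0 hΩ
  have hk1 : ((n : ℤ) + 2 - 1).negOnePow = -1 :=
    Int.negOnePow_odd _ ⟨(n : ℤ) / 2 * 1 + t - t, by omega⟩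
  refine ⟨Ωm * I, Ωp, mul_ne_zero (by exact_mod_cast hm) I_ne_zero, by exact_mod_cast hp,
    fun n' h1 h2 ↦ ⟨fun hpar ↦ ?_, fun hpar ↦ ?_⟩, ?_, ?_, ?_⟩
  · -- `+` parity: `n'` odd
    rw [hk1, Int.negOnePow_eq_neg_one_iff] at hpar
    obtain ⟨m, hm'⟩ := hpar
    obtain ⟨j, rfl⟩ : ∃ j : ℕ, n' = j + 1 := ⟨n' - 1, by omega⟩
    have hjev : Even j := ⟨m.toNat, by omega⟩
    exact heven j (by omega) hjev
  · -- `-` parity: `n'` even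
    rw [hk1, neg_neg, Int.negOnePow_eq_one_iff] at hpar
    obtain ⟨m, hm'⟩ := hpar
    obtain ⟨j, rfl⟩ : ∃ j : ℕ, n' = j + 1 := ⟨n' - 1, by omega⟩
    have hjodd : Odd j := ⟨(m - 1).toNat, by omega⟩
    exact hodd j (by omega) (by omega) hjodd
  · -- Prop. 5.11(b): `ω⁺\overline{ω⁻}/(i2^{k-1}(f,f)) = 2^{-(n+1)} · Ω⁺Ω⁻/(f,f)`
    have hPpos : 0 < (peterssonProduct (Gamma0 N) ((n : ℤ) + 2) f f).re :=
      peterssonProduct_self_pos_holds (Gamma0 N) ((n : ℤ) + 2) (IsNormalized.ne_zero_gamma0 hf.2.2)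
    have hP0 : peterssonProduct (Gamma0 N) ((n : ℤ) + 2) f f ≠ 0 := by
      intro h; rw [h] at hPpos; simp at hPpos
    have h2 : ((2 : ℂ) ^ ((n : ℤ) + 2 - 1)) = 2 ^ (n + 1) := by
      rw [show (n : ℤ) + 2 - 1 = ((n + 1 : ℕ) : ℤ) by push_cast; ring, zpow_natCast]
    rw [h2, Complex.conj_ofReal]
    have hrew : (Ωm : ℂ) * I * Ωp / (I * 2 ^ (n + 1) * peterssonProduct (Gamma0 N) ((n : ℤ) + 2) f f) =
        (2 ^ (n + 1))⁻¹ * ((Ωp : ℂ) * Ωm / peterssonProduct (Gamma0 N) ((n : ℤ) + 2) f f) := by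
      field_simp
    rw [hrew]
    refine mul_mem (inv_mem (pow_mem ?_ _)) hb
    exact_mod_cast natCast_mem (coeffField f) 2
  · refine ⟨-((-1) ^ t * Ωm), ?_⟩
    rw [show (n : ℤ) + 2 + 1 = ((2 * (t + 1) + 1 : ℕ) : ℤ) by rw [hn_def]; push_cast; ring,
      zpow_natCast, pow_succ, pow_mul, I_sq]
    push_cast
    have hsq : ((-1 : ℂ) ^ t) * ((-1 : ℂ) ^ t) = 1 := by
      rw [← pow_add, ← two_mul, pow_mul, neg_one_sq, one_pow]
    linear_combination (-((Ωm : ℂ) * I)) * hsq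
  · refine ⟨(-1) ^ (t + 1) * Ωp, ?_⟩
    rw [show (n : ℤ) + 2 = ((2 * (t + 1) : ℕ) : ℤ) by rw [hn_def]; push_cast; ring, zpow_natCast,
      pow_mul, I_sq]
    push_cast
    have hsq : ((-1 : ℂ) ^ (t + 1)) * ((-1 : ℂ) ^ (t + 1)) = 1 := by
      rw [← pow_add, ← two_mul, pow_mul, neg_one_sq, one_pow]
    linear_combination (-(Ωp : ℂ)) * hsq

/-- **Paşol–Popa Prop. 5.11 (b),(c) and Cor. 5.12 — corrected statement.** Let `f ∈ S_k(Γ₀(N))` be a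
newform with coefficient field `K_f`. There are nonzero periods `ω⁺, ω⁻ ∈ ℂ` such that
(Cor. 5.12) `iⁿΛ(n,f)/ω⁺ ∈ K_f` for the critical integers `0 < n < k` with `(-1)ⁿ = (-1)^{k-1}` and
`iⁿΛ(n,f)/ω⁻ ∈ K_f` for those with `(-1)ⁿ = -(-1)^{k-1}` (`Λ(s,f) = completedLValue f s`);
(Prop. 5.11(b)) `ω⁺\overline{ω⁻}/(i 2^{k-1} (f,f)) ∈ K_f` for even `k`, and
`|ω^±|²/(2^{k-1}(f,f)) ∈ K_f` for odd `k`; (Prop. 5.11(c)) if `f` has real Fourier coefficients then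
`ω⁺ ∈ i^{k+1}ℝ`, `ω⁻ ∈ i^kℝ`.

This is `PasolPopa2013_criticalValuesRationality` with the single correction `2^{k-1}` for the
misprinted `(2π)^{k-1}` in clause (b): the printed Prop. 5.11(b) carries `(2π)^{k-1}`, but its proof
(Thm. 3.3, `3·2^{-(k-1)}·(2i)^{k-1}(f,f) = …`, with `ω^±` built from `Λ(n,f) = ∫₀^∞ f(it)tⁿ⁻¹dt`, which
already contain the powers of `2π`) yields `2^{k-1}`, and the `(2π)^{k-1}` version is false for `f = Δ`
(`Λ(1,Δ)Λ(2,Δ)/(Δ,Δ) ∈ ℚ`). On `Γ₀(N)` (trivial character) odd weights carry no nonzero forms, so the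
odd clause is vacuous. [cite: PasolPopa2013, Prop. 5.11 (b),(c), Cor. 5.12 and Thm. 3.3] -/
def PasolPopa2013_criticalValuesRationalityCorrected : Prop :=
  ∀ (N : ℕ) [NeZero N] (k : ℤ) (f : CuspForm (Gamma0 N) k), IsNewform0 f →
    ∃ ωp ωm : ℂ, ωp ≠ 0 ∧ ωm ≠ 0 ∧
      (∀ n : ℕ, 0 < n → (n : ℤ) < k →
        ((n : ℤ).negOnePow = (k - 1).negOnePow →
          I ^ n * completedLValue f n / ωp ∈ coeffField f) ∧
        ((n : ℤ).negOnePow = -(k - 1).negOnePow →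
          I ^ n * completedLValue f n / ωm ∈ coeffField f)) ∧
      (Even k → ωp * (starRingEnd ℂ) ωm /
          (I * (2 : ℂ) ^ (k - 1) * peterssonProduct (Gamma0 N) k f f) ∈ coeffField f) ∧
      (Odd k →
        ((‖ωp‖ ^ 2 : ℝ) : ℂ) / ((2 : ℂ) ^ (k - 1) * peterssonProduct (Gamma0 N) k f f) ∈
          coeffField f ∧
        ((‖ωm‖ ^ 2 : ℝ) : ℂ) / ((2 : ℂ) ^ (k - 1) * peterssonProduct (Gamma0 N) k f f) ∈
          coeffField f) ∧
      (HasRealCoefficients f →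
        (∃ r : ℝ, ωp = I ^ (k + 1) * r) ∧ (∃ r : ℝ, ωm = I ^ k * r))

/-- **Proof of the corrected Paşol–Popa Prop. 5.11 / Cor. 5.12** (`PasolPopa2013_criticalValuesRationalityCorrected`):
Eichler–Shimura–Manin rationality of the critical values (`PeriodRationalityProofs`) and Haberland's
formula on `Γ₀(N)` (`HaberlandFormulaProofs`, `HaberlandRationalityProofs`). [cite: PasolPopa2013, Prop. 5.11 (b),(c), Cor. 5.12, Thm. 3.2(a), Thm. 3.3, Lemma 4.1] -/
theorem PasolPopa2013_criticalValuesRationalityCorrected_holds :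
    PasolPopa2013_criticalValuesRationalityCorrected :=
  PasolPopa2013_criticalValuesRationality_corrected_of_partB
    fun _ _ _ _ hf hk hk4 ↦ hf.criticalValues_petersson_mem_coeffField hk hk4

end Literature.NumberTheory.EllipticCurves.ModularForms
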